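import Literature.Geometry.Lorentzian.KillingOnPeriodicFlow
import HarnessLib

/-!
# Completeness inside an open set from a priori compact confinement (local Killing fields)

Companion of `KillingOnPeriodicFlow.lean`.  Let `Z` be a Killing field of a `C^∞` pseudo-Riemannian
metric `g` ON an open set `W` of a Hausdorff manifold `M` modelled on `ℝ^d` (`IsKillingFieldOn`).  If
for every `x ∈ W` and every time bound `T` there is a compact `K ⊆ W` containing `γ t`, `|t| ≤ T`, for
every integral curve `γ` of `Z` through `γ 0 = x` defined on an open interval about `0` and staying in
`W`, then through every point of `W` there is a WHOLE-LINE integral curve of `Z` staying in `W` — the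
completeness hypothesis of `IsKillingFieldOn.exists_periodicFlow`.  This is the escape lemma / "a
priori bounds give completeness" (Lee 2013, Lemma 9.19; Bröcker–Jänich (8.11); the tree's
`Manifold.exists_isMIntegralCurve_of_apriori_isCompact`) read on the open sub-carrier `↥W`, where
`Z|W` is a global `C^∞` field (`IsKillingFieldOn.isKillingField_restrict`), integral curves of `Z|W`
being the integral curves of `Z` inside `W` (`isMIntegralCurveOn_subtypeVal_comp`,
`isMIntegralCurve_subtypeVal_comp_iff`).  In the crux `NonTrappingHawkingRigidity` (stub
`stub_farAxialSeed`) the compact sets come from the level sets of `g(T,T)`, invariant under the flow of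
a `T`-commuting Killing field (`KillingOnNormInvariance.lean`) and compact modulo the stationary flow.

Everything here is proved; no definitions, no named facts.

## References
* J. M. Lee, *Introduction to Smooth Manifolds*, 2nd ed. (2013), Thm. 9.12, Lemma 9.19. [LeeSmoothManifolds2013]
* B. O'Neill, *Semi-Riemannian geometry*, Academic Press 1983, Ch. 1, Lemma 1.56 ff.; Ch. 9, Def. 9.22. [ONeillSemiRiemannian1983]
-/

noncomputable section

open Set Filter Function Bundle TopologicalSpace VectorField Literature.Geometry.Manifold
open scoped Manifold ContDiff Topology

namespace Literature.Geometry.Lorentzian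

/-! ### Integral curves on a parameter set, read on an open submanifold -/

section Opens

variable {E : Type*} [NormedAddCommGroup E] [NormedSpace ℝ E] {H : Type*} [TopologicalSpace H]
  {I : ModelWithCorners ℝ E H} {M : Type*} [TopologicalSpace M] [ChartedSpace H M]

/-- **An integral curve of `V|U` on a parameter set is, composed with the inclusion, an integral
curve of `V` on that set** (`dι = id`, `hasMFDerivAt_subtypeVal`; the `IsMIntegralCurveOn` half of
`isMIntegralCurve_subtypeVal_comp_iff`). Lee 2013, Prop. 3.9; O'Neill 1983, Ch. 1, p. 7. [folklore] -/
theorem isMIntegralCurveOn_subtypeVal_comp (U : Opens M) {V : Π x : M, TangentSpace I x}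
    {γ : ℝ → U} {s : Set ℝ}
    (h : IsMIntegralCurveOn (I := I) γ (fun y : U ↦ (V y.1 : TangentSpace I y)) s) :
    IsMIntegralCurveOn (Subtype.val ∘ γ) V s := fun t ht ↦
  ((hasMFDerivAt_subtypeVal (I' := I) (γ t)).comp_hasMFDerivWithinAt t
    (h t ht)).congr_mfderiv (ContinuousLinearMap.ext fun _ ↦ rfl)

end Opens

/-! ### A priori compact confinement inside `W` gives whole-line integral curves inside `W` -/

namespace PseudoRiemannianMetric

universe u

variable {d : ℕ} {M : Type u} [TopologicalSpace M] [ChartedSpace (EuclideanSpace ℝ (Fin d)) M]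
  [IsManifold (𝓡 d) ∞ M] [T2Space M]
  {g : PseudoRiemannianMetric (𝓡 d) ∞ (EuclideanSpace ℝ (Fin d)) (TangentSpace (𝓡 d) : M → Type _)}
  [g.HasLeviCivita]

/-- **A priori compact confinement inside an open set gives completeness inside it** (for a Killing
field on the set; Lee 2013, Lemma 9.19 / Thm. 9.12 read on the open sub-carrier).  Let `Z` be a
Killing field of `g` on the open `W`, and suppose that for every `x ∈ W` and `T : ℝ` there is a compact
`K ⊆ W` such that every integral curve `γ` of `Z` on an open order-connected `J ∋ 0` with `γ 0 = x` and
`γ(J) ⊆ W` satisfies `γ t ∈ K` for `t ∈ J`, `|t| ≤ T`.  Then through every `x ∈ W` there is an integral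
curve `γ : ℝ → M` of `Z` with `γ 0 = x` and `γ(ℝ) ⊆ W`. [cite: LeeSmoothManifolds2013, Lemma 9.19 and Thm. 9.12] -/
theorem IsKillingFieldOn.exists_isMIntegralCurve_mem_of_apriori_isCompact {W : Set M}
    (hWo : IsOpen W) {Z : Π x : M, TangentSpace (𝓡 d) x} (hZ : g.IsKillingFieldOn Z W)
    (hb : ∀ x ∈ W, ∀ T : ℝ, ∃ K : Set M, IsCompact K ∧ K ⊆ W ∧
      ∀ (γ : ℝ → M) (J : Set ℝ), IsOpen J → J.OrdConnected → (0 : ℝ) ∈ J → γ 0 = x →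
        IsMIntegralCurveOn γ Z J → (∀ t ∈ J, γ t ∈ W) → ∀ t ∈ J, |t| ≤ T → γ t ∈ K) :
    ∀ x ∈ W, ∃ γ : ℝ → M, γ 0 = x ∧ IsMIntegralCurve γ Z ∧ ∀ s, γ s ∈ W := by
  intro x hx
  set U : Opens M := ⟨W, hWo⟩ with hU
  set gU := g.restrict PseudoRiemannianMetric.contMDiff_restrict_holds U with hgU
  haveI hLC : gU.HasLeviCivita := gU.hasLeviCivita
  set ZU : Π y : U, TangentSpace (𝓡 d) y := fun y ↦ (Z y.1 : TangentSpace (𝓡 d) y) with hZU_def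
  have hZU : gU.IsKillingField ZU := hZ.isKillingField_restrict U hWo Subset.rfl
  have hZUs : ContMDiff (𝓡 d) (𝓡 d).tangent ((⊤ : ℕ∞) : ℕ∞ω)
      (fun y : U ↦ (⟨y, ZU y⟩ : TangentBundle (𝓡 d) U)) := hZU.contMDiff
  -- the a priori bound, read on `↥W`
  have hbU : ∀ (y : U) (T : ℝ), ∃ K : Set U, IsCompact K ∧
      ∀ (γ : ℝ → U) (J : Set ℝ), IsOpen J → J.OrdConnected → (0 : ℝ) ∈ J → γ 0 = y →
        IsMIntegralCurveOn γ ZU J → ∀ t ∈ J, |t| ≤ T → γ t ∈ K := by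
    intro y T
    obtain ⟨K, hK, hKW, hKγ⟩ := hb y.1 y.2 T
    refine ⟨(Subtype.val : U → M) ⁻¹' K, ?_, fun γ J hJ hJc h0 hγ0 hγ t ht hT ↦ ?_⟩
    · exact Topology.IsInducing.subtypeVal.isCompact_preimage_iff (by
        rintro z hz; exact ⟨⟨z, hKW hz⟩, rfl⟩) |>.2 hK
    · have h1 : IsMIntegralCurveOn (Subtype.val ∘ γ) Z J := isMIntegralCurveOn_subtypeVal_comp U hγ
      exact hKγ (Subtype.val ∘ γ) J hJ hJc h0 (by simp [hγ0]) h1 (fun t _ ↦ (γ t).2) t ht hT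
  obtain ⟨γ, hγ0, hγ⟩ :=
    exists_isMIntegralCurve_of_apriori_isCompact (I := 𝓡 d) (M := U) (n := (⊤ : ℕ∞)) hZUs le_top
      hbU ⟨x, hx⟩
  exact ⟨Subtype.val ∘ γ, by simp [hγ0], (isMIntegralCurve_subtypeVal_comp_iff U).2 hγ,
    fun s ↦ (γ s).2⟩

end PseudoRiemannianMetric

end Literature.Geometry.Lorentzian

end
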